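import Mathlib
import HarnessLib
import Summits.HubbardSuperconductivity.HubbardSuperconductivity.Theorems.KLProgrammeC4aRadialRowOne
import Summits.HubbardSuperconductivity.HubbardSuperconductivity.Theorems.KLProgrammeC4aRigidConfigurations

/-!
# Route `KLProgramme` — crux C4a, S3 brick (B2, Cooper, orders 0–1): the partner band of the co-moving bubble loop is SOFT near the Cooper configuration —
# `|ē − e| ≤ K₁·‖S(0)‖` and `|∂_t ē(0)| ≤ K₁·‖S′(0)‖ + K₂·‖S(0)‖·msD₁`, uniformly in the loop variables

Cell `gate-hubbard-kl`, lane hubbard-kl-c4a-1 (g6); helper for stub (C) `stub_twoLeg_curvature` of the engine-flow child `KLRegimeEngineV17F2`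
(stmt-HubbardSuperconductivity-20437); memo HOME/hubbard-kl-c4a-1/C4A-PLAN.md §24.4 (i).  With the pair-sum path `S(t) = Φ(0,θ+t) + Φ(ρ,ϑ+θ+t)` and the loop point rotated
with the flow, `γ(t) = Φ(e, α+t)`, the partner band of the pp bubble is `ē(t) = e_K(S(t) − γ(t))`.  At the Cooper configuration `S ≡ 0` and `ē ≡ e`
(`…C4aPartnerBandCritical.partnerBand_pp_cooper`); here the quantitative version, from the global sizes `‖De_K‖ ≤ K₁`, `‖D²e_K‖ ≤ K₂` and g5's rigidity of the path
(`…C4aPathRigidity.norm_pairSumPath_zero_le`: `‖S(0)‖ ≤ |ρ|/d + msD₁·|ϑ − π|`; `…C4aRadialRowOne.norm_deriv_pairSumPath_le_rigid`: `‖S′(0)‖ ≤ radialRowOneConst·|ρ| + msD₂·|ϑ − π|`):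

* `abs_partnerBand_pp_sub_le`: `|e_K(S(0) − Φ(e,α)) − e| ≤ K₁·(|ρ|/d + msD₁|ϑ − π|)` (mean value against `e_K(−Φ(e,α)) = e`);
* **`abs_deriv_partnerBand_pp_le`**: `|∂_t|₀ e_K(S(t) − Φ(e,α+t))| ≤ K₁·(radialRowOneConst·|ρ| + msD₂|ϑ−π|) + K₂·(|ρ|/d + msD₁|ϑ−π|)·msD₁` — the ANISOTROPY DEFECT `𝒜` of memo
  §24.4 at first order is `O(|ρ| + |ϑ − π|)` for EVERY loop level `|e| < r` and loop angle `α` (`∂_t e_K(−Φ(e,α+t)) = 0` supplies the cancellation).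

Pure calculus on landed objects; nothing about sizes of the model; nothing asserts superconductivity.  References: FST II CPAM 51 (1998) §3 Thm 3.5; BGM 2006 §2.4 (2.40)
[cite: BenfattoGiulianiMastropietro2006].
-/

noncomputable section

namespace Summit.HubbardSuperconductivity.HubbardSuperconductivity.Theorems.C4a

set_option linter.dupNamespace false -- summit = problem name (single-conjunct summit), D-0017

open Real Set Filter
open scoped Topology
open Literature.MathematicalPhysics.QuantumLattice Literature.MathematicalPhysics.QuantumLattice.BandSectorCounting Literature.Probability.LatticeModels
open Summit.HubbardSuperconductivity.HubbardSuperconductivity.Theorems.KLRegimeSplit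
open Summit.HubbardSuperconductivity.HubbardSuperconductivity.Theorems.DispersionFlow
open Summit.HubbardSuperconductivity.HubbardSuperconductivity.Theorems.PerturbedFermiCurve

section Sizes

variable {K : TrigPolyC4v} {A : ℝ} (hA : ∀ p : Momentum, ∀ j ≤ 2, ‖iteratedFDeriv ℝ j (frameShift K) p‖ ≤ A) (hA20 : A ≤ 1 / 20)
  (hd : klCurveD ≤ (bandBounds (show (-4 : ℝ) < -1.1 by norm_num) (show (-1.1 : ℝ) ≤ -0.1 by norm_num)
    (show (-0.1 : ℝ) < 0 by norm_num)).Dtmin - 2 * A)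
  {μ r : ℝ} (hr : 0 < r) (hlo : (-1.1 : ℝ) < μ - r - A) (hhi : μ + r + A < -0.1)
  {A₃ A₄ : ℝ} (hA₃ : ∀ p : Momentum, ‖iteratedFDeriv ℝ 3 (frameShift K) p‖ ≤ A₃)
  (hA₄ : ∀ p : Momentum, ‖iteratedFDeriv ℝ 4 (frameShift K) p‖ ≤ A₄)
  {K₁ K₂ : ℝ} (hK₁ : ∀ p : Momentum, ‖fderiv ℝ (frameLevel μ K) p‖ ≤ K₁) (hK₂ : ∀ p : Momentum, ‖iteratedFDeriv ℝ 2 (frameLevel μ K) p‖ ≤ K₂)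
include hA hA20 hd hr hlo hhi hA₃ hA₄ hK₁ hK₂

omit hA hA20 hd hr hlo hhi hA₃ hA₄ hK₂ in
/-- The frame band is `K₁`-Lipschitz. -/
theorem abs_frameLevel_sub_le (x y : Momentum) : |frameLevel μ K x - frameLevel μ K y| ≤ K₁ * ‖x - y‖ := by
  have hdiff : Differentiable ℝ (frameLevel μ K) := (EngineV8.contDiff_frameLevel μ K (n := 1)).differentiable one_ne_zero
  have h := (convex_univ (𝕜 := ℝ) (E := Momentum)).norm_image_sub_le_of_norm_fderiv_le (fun z _ => hdiff z) (fun z _ => hK₁ z) (mem_univ y) (mem_univ x)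
  rwa [Real.norm_eq_abs] at h

omit hA hA20 hd hr hlo hhi hA₃ hA₄ hK₁ in
/-- The gradient of the frame band is `K₂`-Lipschitz. -/
theorem norm_fderiv_frameLevel_sub_le (x y : Momentum) : ‖fderiv ℝ (frameLevel μ K) x - fderiv ℝ (frameLevel μ K) y‖ ≤ K₂ * ‖x - y‖ := by
  have he := EngineV8.contDiff_frameLevel μ K (n := 2)
  have hdiff : Differentiable ℝ (fderiv ℝ (frameLevel μ K)) := (he.fderiv_right (m := 1) (by norm_num)).differentiable one_ne_zero
  exact (convex_univ (𝕜 := ℝ) (E := Momentum)).norm_image_sub_le_of_norm_fderiv_le (fun z _ => hdiff z)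
    (fun z _ => by rw [norm_fderiv_two_eq_norm_iteratedFDeriv]; exact hK₂ z) (mem_univ y) (mem_univ x)

omit hA20 hd hr hA₃ hA₄ hK₁ hK₂ in
/-- `e_K(−Φ(e, s)) = e` on the tube. -/
theorem frameLevel_neg_levelPoint_tube {e : ℝ} (he : |e| < r) (s : ℝ) : frameLevel μ K (-levelPoint μ K e s) = e := by
  have h := abs_lt.1 he
  exact frameLevel_neg_levelPoint (bandBounds (show (-4 : ℝ) < -1.1 by norm_num) (show (-1.1 : ℝ) ≤ -0.1 by norm_num) (show (-0.1 : ℝ) < 0 by norm_num))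
    hA (ρ := e) (by linarith) (by linarith) s

omit hK₂ in
/-- **ORDER 0**: the partner band deviates from the loop level by at most `K₁·‖S(0)‖ ≤ K₁·(|ρ|/d + msD₁·|ϑ − π|)`, for every loop level `|e| < r` and angle `α`. -/
theorem abs_partnerBand_pp_sub_le {ρ : ℝ} (hρ : |ρ| < r) {e : ℝ} (he : |e| < r) (ϑ θ α : ℝ) :
    |frameLevel μ K (pairSumPath μ K ρ ϑ θ 0 - levelPoint μ K e α) - e| ≤
      K₁ * (|ρ| / ((bandBounds (show (-4 : ℝ) < -1.1 by norm_num) (show (-1.1 : ℝ) ≤ -0.1 by norm_num) (show (-0.1 : ℝ) < 0 by norm_num)).Dtmin - 2 * A) +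
        msD A₃ A₄ 1 * |ϑ - π|) := by
  have hK₁0 : 0 ≤ K₁ := (norm_nonneg _).trans (hK₁ 0)
  have h1 := abs_frameLevel_sub_le hK₁ (pairSumPath μ K ρ ϑ θ 0 - levelPoint μ K e α) (-levelPoint μ K e α)
  rw [frameLevel_neg_levelPoint_tube hA hlo hhi he, show pairSumPath μ K ρ ϑ θ 0 - levelPoint μ K e α - -levelPoint μ K e α = pairSumPath μ K ρ ϑ θ 0 by abel]
    at h1
  exact h1.trans (mul_le_mul_of_nonneg_left (norm_pairSumPath_zero_le hA hA20 hd hr hlo hhi hA₃ hA₄ hρ ϑ θ) hK₁0)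

/-- **ORDER 1 — THE ANISOTROPY DEFECT NEAR COOPER**: for every loop level `|e| < r` and loop angle `α`,
`|∂_t|₀ e_K(S(t) − Φ(e, α+t))| ≤ K₁·(radialRowOneConst·|ρ| + msD₂·|ϑ − π|) + K₂·(|ρ|/d + msD₁·|ϑ − π|)·msD₁` — `O(|ρ| + |ϑ − π|)`, uniformly in the loop. -/
theorem abs_deriv_partnerBand_pp_le {ρ : ℝ} (hρ : |ρ| < r) {e : ℝ} (he : |e| < r) (ϑ θ α : ℝ) :
    |deriv (fun t : ℝ => frameLevel μ K (pairSumPath μ K ρ ϑ θ t - levelPoint μ K e (α + t))) 0| ≤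
      K₁ * (radialRowOneConst A ((bandBounds (show (-4 : ℝ) < -1.1 by norm_num) (show (-1.1 : ℝ) ≤ -0.1 by norm_num) (show (-0.1 : ℝ) < 0 by norm_num)).Dtmin -
          2 * A) * |ρ| + msD A₃ A₄ 2 * |ϑ - π|) +
        K₂ * (|ρ| / ((bandBounds (show (-4 : ℝ) < -1.1 by norm_num) (show (-1.1 : ℝ) ≤ -0.1 by norm_num) (show (-0.1 : ℝ) < 0 by norm_num)).Dtmin - 2 * A) +
          msD A₃ A₄ 1 * |ϑ - π|) * msD A₃ A₄ 1 := by
  set B₀ := bandBounds (show (-4 : ℝ) < -1.1 by norm_num) (show (-1.1 : ℝ) ≤ -0.1 by norm_num) (show (-0.1 : ℝ) < 0 by norm_num) with hB₀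
  have hADt : 2 * A < B₀.Dtmin := by have := klCurveD_pos; linarith
  have hK₁0 : 0 ≤ K₁ := (norm_nonneg _).trans (hK₁ 0)
  have hK₂0 : 0 ≤ K₂ := (norm_nonneg _).trans (hK₂ 0)
  set S := pairSumPath μ K ρ ϑ θ with hSdef
  set γ : ℝ → Momentum := fun t => levelPoint μ K e (α + t) with hγdef
  -- differentiability of the two paths at `t = 0`
  have hS : HasDerivAt S (deriv S 0) 0 :=
    (((contDiff_pairSumPath B₀ hA hADt hr hlo hhi hρ ϑ θ (m := 1)).differentiable one_ne_zero) 0).hasDerivAt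
  have hγd : HasDerivAt γ (deriv (levelPoint μ K e) α) 0 := by
    have h := (((contDiff_levelPoint_angle B₀ hA hADt hlo hhi he (m := 1)).differentiable one_ne_zero) (α + 0)).hasDerivAt
    rw [add_zero] at h
    exact HasDerivAt.comp_const_add α 0 (by rw [add_zero]; exact h)
  -- the band along the two composites
  have hFd : Differentiable ℝ (frameLevel μ K) := (EngineV8.contDiff_frameLevel μ K (n := 1)).differentiable one_ne_zero
  have hEbar := (hFd (S 0 - γ 0)).hasFDerivAt.comp_hasDerivAt (0 : ℝ) (hS.sub hγd)
  have hGbar := (hFd (-γ 0)).hasFDerivAt.comp_hasDerivAt (0 : ℝ) hγd.neg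
  -- the reference composite `t ↦ e_K(−Φ(e, α+t))` is the constant `e`
  have hconst : HasDerivAt (frameLevel μ K ∘ fun t : ℝ => -γ t) 0 0 := by
    have hfun : (frameLevel μ K ∘ fun t : ℝ => -γ t) = fun _ => e := funext fun t => frameLevel_neg_levelPoint_tube hA hlo hhi he (α + t)
    rw [hfun]; exact hasDerivAt_const 0 e
  have hzero : fderiv ℝ (frameLevel μ K) (-γ 0) (-deriv (levelPoint μ K e) α) = 0 := hGbar.unique hconst
  -- the value of the derivative, rearranged around the reference
  have hval : deriv (fun t : ℝ => frameLevel μ K (S t - γ t)) 0 =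
      fderiv ℝ (frameLevel μ K) (S 0 - γ 0) (deriv S 0) +
        (fderiv ℝ (frameLevel μ K) (S 0 - γ 0) - fderiv ℝ (frameLevel μ K) (-γ 0)) (-deriv (levelPoint μ K e) α) := by
    rw [show (fun t : ℝ => frameLevel μ K (S t - γ t)) = frameLevel μ K ∘ (S - γ) from rfl, hEbar.deriv,
      show (fderiv ℝ (frameLevel μ K) (S 0 - γ 0) - fderiv ℝ (frameLevel μ K) (-γ 0)) (-deriv (levelPoint μ K e) α) =
        fderiv ℝ (frameLevel μ K) (S 0 - γ 0) (-deriv (levelPoint μ K e) α) - fderiv ℝ (frameLevel μ K) (-γ 0) (-deriv (levelPoint μ K e) α) from rfl,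
      hzero, sub_zero, map_sub, map_neg]
    ring
  -- sizes of the pieces
  have hS0 : ‖S 0‖ ≤ |ρ| / (B₀.Dtmin - 2 * A) + msD A₃ A₄ 1 * |ϑ - π| := norm_pairSumPath_zero_le hA hA20 hd hr hlo hhi hA₃ hA₄ hρ ϑ θ
  have hS1 : ‖deriv S 0‖ ≤ radialRowOneConst A (B₀.Dtmin - 2 * A) * |ρ| + msD A₃ A₄ 2 * |ϑ - π| := by
    rw [← iteratedDeriv_one]; exact norm_deriv_pairSumPath_le_rigid hA hA20 hd hr hlo hhi hA₃ hA₄ hρ ϑ θ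
  have hγ1 : ‖-deriv (levelPoint μ K e) α‖ ≤ msD A₃ A₄ 1 := by
    rw [norm_neg, ← iteratedDeriv_one]; exact norm_iteratedDeriv_levelPoint_le hA hA20 hd hlo hhi hA₃ hA₄ he (i := 1) le_rfl (by norm_num) α
  have hpt : S 0 - γ 0 - -γ 0 = S 0 := by abel
  have hL : ‖fderiv ℝ (frameLevel μ K) (S 0 - γ 0) - fderiv ℝ (frameLevel μ K) (-γ 0)‖ ≤ K₂ * ‖S 0‖ := by
    have h := norm_fderiv_frameLevel_sub_le hK₂ (S 0 - γ 0) (-γ 0); rwa [hpt] at h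
  have h1 : |fderiv ℝ (frameLevel μ K) (S 0 - γ 0) (deriv S 0)| ≤ K₁ * ‖deriv S 0‖ := by
    rw [← Real.norm_eq_abs]; exact (ContinuousLinearMap.le_opNorm _ _).trans (mul_le_mul_of_nonneg_right (hK₁ _) (norm_nonneg _))
  have h2 : |(fderiv ℝ (frameLevel μ K) (S 0 - γ 0) - fderiv ℝ (frameLevel μ K) (-γ 0)) (-deriv (levelPoint μ K e) α)| ≤ K₂ * ‖S 0‖ * msD A₃ A₄ 1 := by
    rw [← Real.norm_eq_abs]
    refine (ContinuousLinearMap.le_opNorm _ _).trans ?_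
    exact mul_le_mul hL hγ1 (norm_nonneg _) (mul_nonneg hK₂0 (norm_nonneg _))
  have hD1 : 0 ≤ msD A₃ A₄ 1 := (norm_nonneg _).trans hγ1
  have hfun : (fun t : ℝ => frameLevel μ K (pairSumPath μ K ρ ϑ θ t - levelPoint μ K e (α + t))) = fun t : ℝ => frameLevel μ K (S t - γ t) := rfl
  rw [hfun, hval]
  refine (abs_add_le _ _).trans (add_le_add (h1.trans (mul_le_mul_of_nonneg_left hS1 hK₁0)) (h2.trans ?_))
  exact mul_le_mul_of_nonneg_right (mul_le_mul_of_nonneg_left hS0 hK₂0) hD1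

end Sizes

end Summit.HubbardSuperconductivity.HubbardSuperconductivity.Theorems.C4a

end
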